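import Summits.AtomisticToContinuum.FouriersLaw.Theses.BondHeatUncertainty
import Summits.AtomisticToContinuum.FouriersLaw.Theses.BoundaryEscapeDeficit

/-!
# Crux-strategist s2 (stmt-AtomisticToContinuum-9120 `SubdiffusiveBondHeat`): typed S⁺ signatures of the census §Strengthen

Defs only (no claims proved here).  `K_N(u) = ∫ (p₀² − T)·P_u(p₀² − T) dμ_T^N` is spelled VERBATIM as the `let K` of route
`BoundaryEscapeDeficit` (`dite` on `0 < N` included), so that every def below zeta-reduces onto the objects of the live line
`bath-bond-deficit-integral` and of `StrategistCircularityWitness.lean`.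

* `ContactNoiseCeiling`   — S⁺_F: `(γ/T²)∫₀^∞ cos(ωu) K_N(u) du ≤ 1` for EVERY ω (the boundary noise spectrum never exceeds the bath level
                             `2T²/γ`; at ω = 0 it is `E_N ≥ 0`).  Expected provable now from the landed bath-bond reduction; free, phonon-true.
* `ContactWarburgModulus` — S⁺_G: `(γ/T²)∫₀^∞ (1 − cos(ωu)) K_N(u) du ≤ C√|ω|` for `|ω| ≤ 1`, `N ≥ N₀` (√ω Warburg cusp bound of the
                             dip `s_N(0) − s_N(ω)`; implies `TransientEW` by `W_N(t) − tE_N = (γ/2πT²)∫(s_N(0)−s_N(ω))(1−cos ωt)ω⁻² dω`).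
* `HalfLineEW`            — S⁺_H(a): once-integrated upper half of `BoundaryEscapeDeficit.HalfChainTailLaw`, eventually in the length `M`.
* `BoundaryComparison`    — S⁺_H(b): the `N`-chain's transient is dominated by the half-line deficit on the Thouless window.
-/

noncomputable section

open MeasureTheory Filter Topology Set
open Literature.MathematicalPhysics.KineticTheory.HeatConduction

namespace Summit.AtomisticToContinuum.FouriersLaw.Cruxes.SubdiffusiveBondHeat.Strategist

/-- S⁺_F — all-frequency ceiling of the boundary kinetic-energy noise spectrum (`s_N(ω) ≤ 2T²/γ`), N-uniform, free. -/
def ContactNoiseCeiling : Prop :=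
  ∀ ω₂ lam β γ : ℝ, 0 < ω₂ → 0 < lam → 0 < β → 0 < γ → ∀ T : ℝ, 0 < T → ∀ N : ℕ, 2 ≤ N → ∀ ω : ℝ,
    γ / T ^ 2 * (∫ u in Set.Ioi (0 : ℝ), Real.cos (ω * u) *
      (if h : 0 < N then
        ∫ z, ((z.2 ⟨0, h⟩) ^ 2 - T) *
            (∫ y, ((y.2 ⟨0, h⟩) ^ 2 - T) ∂((pinnedChain ω₂ lam β γ).transitionKernel N T T u.toNNReal z))
          ∂((pinnedChain ω₂ lam β γ).gibbsMeasure N T)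
      else 0)) ≤ 1

/-- S⁺_G — the √ω WARBURG CUSP bound at the contact (spectral form of the Edwards–Wilkinson factor; strictly stronger than `TransientEW`). -/
def ContactWarburgModulus : Prop :=
  ∀ ω₂ lam β γ : ℝ, 0 < ω₂ → 0 < lam → 0 < β → 0 < γ → ∀ T : ℝ, 0 < T →
    ∃ C : ℝ, ∃ N₀ : ℕ, ∀ N : ℕ, N₀ ≤ N → ∀ ω : ℝ, |ω| ≤ 1 →
      γ / T ^ 2 * (∫ u in Set.Ioi (0 : ℝ), (1 - Real.cos (ω * u)) *
        (if h : 0 < N then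
          ∫ z, ((z.2 ⟨0, h⟩) ^ 2 - T) *
              (∫ y, ((y.2 ⟨0, h⟩) ^ 2 - T) ∂((pinnedChain ω₂ lam β γ).transitionKernel N T T u.toNNReal z))
            ∂((pinnedChain ω₂ lam β γ).gibbsMeasure N T)
        else 0)) ≤ C * Real.sqrt |ω|

/-- S⁺_H(a) — half-line Edwards–Wilkinson law of the bath heat, eventually in the length `M`:
`W_M(t) = ∫₀ᵗ (1 − θ_M) ≤ C√t` for `t ≥ t₀` (integrated upper half of `HalfChainTailLaw`, Ohm-free, false for phonons). -/
def HalfLineEW : Prop :=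
  ∀ ω₂ lam β γ : ℝ, 0 < ω₂ → 0 < lam → 0 < β → 0 < γ → ∀ T : ℝ, 0 < T →
    ∃ C t₀ : ℝ, 0 < t₀ ∧ ∀ t : ℝ, t₀ ≤ t → ∀ᶠ M : ℕ in atTop,
      (∫ s in (0 : ℝ)..t,
        (1 - γ / T ^ 2 * (∫ u in (0 : ℝ)..s,
            if h : 0 < M then
              ∫ z, ((z.2 ⟨0, h⟩) ^ 2 - T) *
                  (∫ y, ((y.2 ⟨0, h⟩) ^ 2 - T) ∂((pinnedChain ω₂ lam β γ).transitionKernel M T T u.toNNReal z))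
                ∂((pinnedChain ω₂ lam β γ).gibbsMeasure M T)
            else 0))) ≤ C * Real.sqrt t

/-- S⁺_H(b) — boundary comparison on the Thouless window: the `N`-chain's once-integrated transient
`∫₀ᵗ (1 − θ_N − E_N)` is dominated by the half-line deficit `W_M(t)` (eventually in `M`), up to `O(1)`.  Phonon-true. -/
def BoundaryComparison : Prop :=
  ∀ ω₂ lam β γ : ℝ, 0 < ω₂ → 0 < lam → 0 < β → 0 < γ → ∀ T : ℝ, 0 < T →
    ∃ C c : ℝ, 0 < c ∧ ∀ᶠ N : ℕ in atTop, ∀ t : ℝ, 1 ≤ t → t ≤ c * (N : ℝ) ^ 2 → ∀ᶠ M : ℕ in atTop,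
      (∫ s in (0 : ℝ)..t,
        (1 - γ / T ^ 2 * (∫ u in (0 : ℝ)..s,
            if h : 0 < N then
              ∫ z, ((z.2 ⟨0, h⟩) ^ 2 - T) *
                  (∫ y, ((y.2 ⟨0, h⟩) ^ 2 - T) ∂((pinnedChain ω₂ lam β γ).transitionKernel N T T u.toNNReal z))
                ∂((pinnedChain ω₂ lam β γ).gibbsMeasure N T)
            else 0) -
          (1 - γ / T ^ 2 * (∫ u in Set.Ioi (0 : ℝ),
            if h : 0 < N then
              ∫ z, ((z.2 ⟨0, h⟩) ^ 2 - T) *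
                  (∫ y, ((y.2 ⟨0, h⟩) ^ 2 - T) ∂((pinnedChain ω₂ lam β γ).transitionKernel N T T u.toNNReal z))
                ∂((pinnedChain ω₂ lam β γ).gibbsMeasure N T)
            else 0)))) ≤
      C * ((∫ s in (0 : ℝ)..t,
        (1 - γ / T ^ 2 * (∫ u in (0 : ℝ)..s,
            if h : 0 < M then
              ∫ z, ((z.2 ⟨0, h⟩) ^ 2 - T) *
                  (∫ y, ((y.2 ⟨0, h⟩) ^ 2 - T) ∂((pinnedChain ω₂ lam β γ).transitionKernel M T T u.toNNReal z))
                ∂((pinnedChain ω₂ lam β γ).gibbsMeasure M T)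
            else 0))) + 1)

end Summit.AtomisticToContinuum.FouriersLaw.Cruxes.SubdiffusiveBondHeat.Strategist

end
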